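import Summits.QuantumFields.YangMills.Theorems.PencilRigidityDiagonalMirrorRPRKmsVarianceDefs

/-!
# Crux `DiagonalMirrorRPR` (stmt-QuantumFields-10604), line `kms-variance-lukewarm-descent`:
# mirror clustering along `e₀` for slab-ordered families (sub-goal `stub_mirrorClustering_axisZero`)

Routes `PencilRigidity` / `MirrorModularBoosts` of `YangMills`, crux `DiagonalMirrorRPR`, registered skeleton
`Cruxes/DiagonalMirrorRPR/Lines/kms_variance_lukewarm_descent.lean` (namespace `…KmsVarianceLukewarmDescent`,
vocabulary `mirrorFamily`, `mirrorCov`, `MirrorClustering` from `…KmsVarianceDefs`).  First of the two modules proving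
the ORDERABLE case of the registered stub `stub_mirrorClustering` (the part of `MirrorClustering S₁` that the package
`W₁` supplies): this module does the axis `e₀`; the sibling `…StubMirrorClusteringOrderable` transports it to `e₁` and
states the registered sub-goal `stub_mirrorClustering_orderable`.

Content (sub-namespace `MirrorOrderable` for the lemmas): §1 sign flips, translations and the supports of mirror
copies (`supp (mirror_d f)ᵢ ⊆ {d − hi ≤ x_μ ≤ d − lo}`); §2 real tensors with factors in pairwise SEPARATED closed time
slabs are in `⁰𝒮`, and the slabs of the joint family `mirror_d g ++ g`; §3 the clustering theorem
`tendsto_mirrorCov_axisZero`: with `s` above all slabs and `F = ⊗_j (mirror_s g)_{n−1−j}` (a FIXED time-ordered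
tensor), translation invariance on `⁰𝒮` and E3 identify `S₁(mirror_d g ⊗ g) = S₁(Θ F* ⊗ T_{d−2s} F)`,
`S₁(mirror_d g) = S₁(F)`, `S₁(g) = S₁(Θ F*)`, so `HasMassGap Δ` bounds `‖mirrorCov S₁ g 0 d‖ ≤ C e^{−Δ(d − 2s)} → 0`.
Then `stub_mirrorClustering_axisZero` (registered signature).

References: K. Osterwalder, R. Schrader, Comm. Math. Phys. 31 (1973) §2–3 (E3, E4 on `𝒮_<`) and 42 (1975) §2;
J. Glimm, A. Jaffe, *Quantum Physics* (2nd ed.) §6.1 and Thm 6.1.3 (exponential clustering from the mass gap).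
-/

set_option autoImplicit false

noncomputable section

open scoped SchwartzMap ComplexConjugate
open MeasureTheory Filter Topology
open Literature.MathematicalPhysics.QuantumLattice Literature.MathematicalPhysics.AQFT
  Literature.MathematicalPhysics.QuantumFieldTheory
open Summit.QuantumFields.YangMills.Cruxes.DiagonalMirrorRPR.ParityBridgeColdTraces
open Summit.QuantumFields.YangMills.Cruxes.DiagonalMirrorRPR.ParityBridgeColdTraces.RpClosure (signFlip ee
  signFlip_apply signFlip_single det_signFlip)

namespace Summit.QuantumFields.YangMills.Cruxes.DiagonalMirrorRPR.KmsVarianceLukewarmDescent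

namespace MirrorOrderable

/-! ## §1 Sign flips, translations and supports -/

section Flips

/-- A sign flip is an involution. -/
theorem signFlip_signFlip (s : Finset (Fin 4)) (x : E4) : signFlip s (signFlip s x) = x := by
  ext i
  rw [signFlip_apply, signFlip_apply]
  split_ifs <;> simp

/-- Hence it is its own inverse. -/
theorem signFlip_symm_apply (s : Finset (Fin 4)) (x : E4) : (signFlip s).symm x = signFlip s x := by
  apply (signFlip s).injective
  rw [LinearIsometryEquiv.apply_symm_apply, signFlip_signFlip]

/-- `t e₀` as `EuclideanSpace.single`. -/
theorem single_eq_smul_ee (t : ℝ) : EuclideanSpace.single (0 : Fin 4) t = t • ee 0 := by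
  ext i
  by_cases hi : i = 0
  · subst hi; simp [ee]
  · simp [ee, hi]

/-- Support of a translate: `supp f(· − a) ⊆ supp f + a`. -/
theorem tsupport_translateTest_subset (a : E4) (h : 𝓢(E4, ℝ)) :
    tsupport (translateTest a h : E4 → ℝ) ⊆ (fun x => x - a) ⁻¹' tsupport (h : E4 → ℝ) := by
  have hfun : (translateTest a h : E4 → ℝ) = (h : E4 → ℝ) ∘ fun x => x - a := by
    funext x; rfl
  rw [hfun]
  exact tsupport_comp_subset_preimage (h : E4 → ℝ) (continuous_id.sub continuous_const)

/-- A time slab is shifted by a time translation. -/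
theorem slab_translateTest {h : 𝓢(E4, ℝ)} {lo hi : ℝ}
    (hh : tsupport (h : E4 → ℝ) ⊆ {x | lo ≤ x 0 ∧ x 0 ≤ hi}) (c : ℝ) :
    tsupport (translateTest (c • ee 0) h : E4 → ℝ) ⊆ {x | lo + c ≤ x 0 ∧ x 0 ≤ hi + c} := by
  intro x hx
  have h1 := hh (tsupport_translateTest_subset _ _ hx)
  simp only [Set.mem_setOf_eq, ee, PiLp.sub_apply, PiLp.smul_apply, PiLp.single_apply, if_true, smul_eq_mul,
    mul_one] at h1
  constructor <;> linarith [h1.1, h1.2]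

variable {n : ℕ}

/-- **Support of a mirror copy**: `supp fᵢ ⊆ {lo ≤ x_μ ≤ hi}` gives
`supp (mirror_d f)ᵢ ⊆ {d − hi ≤ x_μ ≤ d − lo}`. -/
theorem tsupport_mirrorFamily_subset (μ : Fin 4) (d : ℝ) (g : Fin n → 𝓢(E4, ℝ)) {lo hi : Fin n → ℝ}
    (hsupp : ∀ i, tsupport (g i : E4 → ℝ) ⊆ {x | lo i ≤ x μ ∧ x μ ≤ hi i}) (i : Fin n) :
    tsupport (mirrorFamily μ d g i : E4 → ℝ) ⊆ {x | d - hi i ≤ x μ ∧ x μ ≤ d - lo i} := by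
  intro x hx
  have h1 := RpClosure.tsupport_linActTest_subset _ _ (tsupport_translateTest_subset _ _ hx)
  have h2 := hsupp i h1
  simp only [Set.mem_setOf_eq, signFlip_symm_apply, signFlip_apply, Finset.mem_singleton, if_true, ee,
    PiLp.sub_apply, PiLp.smul_apply, PiLp.single_apply, smul_eq_mul, mul_one] at h2
  constructor <;> linarith [h2.1, h2.2]

/-- Translating a mirror copy along its axis shifts the displacement. -/
theorem translateTest_mirrorFamily (μ : Fin 4) (c d : ℝ) (g : Fin n → 𝓢(E4, ℝ)) (i : Fin n) :
    translateTest (c • ee μ) (mirrorFamily μ d g i) = mirrorFamily μ (d + c) g i := by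
  ext x
  simp only [mirrorFamily, translateTest_apply, linActTest_apply]
  congr 1
  congr 1
  rw [add_smul]
  abel

/-- The time reflection of the `e₀`-mirror copy at displacement `s` is the original translated by `−s e₀`. -/
theorem thetaTest_mirrorFamily (s : ℝ) (g : Fin n → 𝓢(E4, ℝ)) (i : Fin n) :
    thetaTest 4 (mirrorFamily 0 s g i) = translateTest ((-s) • ee 0) (g i) := by
  ext x
  simp only [mirrorFamily, thetaTest_apply, translateTest_apply, linActTest_apply]
  congr 1
  rw [signFlip_symm_apply]
  ext j
  rw [signFlip_apply]
  by_cases hj : j = 0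
  · subst hj
    simp [ee]
    ring
  · simp [ee, hj]

end Flips

/-! ## §2 Off-diagonality from separated time slabs -/

section Sep

variable {k : ℕ}

/-- A real tensor product whose factors live in pairwise SEPARATED closed time slabs lies in `⁰𝒮`. -/
theorem isOffDiagonal_of_sep {X : 𝓢((Fin k → E4), ℂ)} {F : Fin k → 𝓢(E4, ℝ)}
    (hX : IsTensorOf X fun p => ofRealTest (F p)) {LO HI : Fin k → ℝ}
    (hsupp : ∀ p, tsupport (F p : E4 → ℝ) ⊆ {x | LO p ≤ x 0 ∧ x 0 ≤ HI p})
    (hsep : ∀ p q, p ≠ q → HI p < LO q ∨ HI q < LO p) : IsOffDiagonal X :=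
  RpClosure.isOffDiagonal_of_isTensorOf_disjoint hX fun p q hpq =>
    Set.disjoint_left.2 fun x hxp hxq => by
      have hp := hsupp p (RpClosure.tsupport_ofRealTest_subset _ hxp)
      have hq := hsupp q (RpClosure.tsupport_ofRealTest_subset _ hxq)
      rcases hsep p q hpq with h | h
      · linarith [hp.1, hp.2, hq.1, hq.2]
      · linarith [hp.1, hp.2, hq.1, hq.2]

/-- The same for the family translated by `c e₀` (the slabs move rigidly). -/
theorem isOffDiagonal_translate_of_sep {X : 𝓢((Fin k → E4), ℂ)} {F : Fin k → 𝓢(E4, ℝ)} (c : ℝ)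
    (hX : IsTensorOf X fun p => ofRealTest (translateTest (c • ee 0) (F p))) {LO HI : Fin k → ℝ}
    (hsupp : ∀ p, tsupport (F p : E4 → ℝ) ⊆ {x | LO p ≤ x 0 ∧ x 0 ≤ HI p})
    (hsep : ∀ p q, p ≠ q → HI p < LO q ∨ HI q < LO p) : IsOffDiagonal X :=
  isOffDiagonal_of_sep hX (LO := fun p => LO p + c) (HI := fun p => HI p + c) (fun p => slab_translateTest (hsupp p) c)
    fun p q hpq => by
      rcases hsep p q hpq with h | h
      · exact Or.inl (by linarith)
      · exact Or.inr (by linarith)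

/-- Ordered slabs are separated. -/
theorem sep_of_ordered {lo hi : Fin k → ℝ} (hord : ∀ i j, i < j → hi i < lo j) :
    ∀ i j, i ≠ j → hi i < lo j ∨ hi j < lo i := fun i j hij => by
  rcases lt_or_gt_of_ne hij with h | h
  · exact Or.inl (hord i j h)
  · exact Or.inr (hord j i h)

/-- The mirror slabs `[d − hi, d − lo]` of ordered slabs are separated. -/
theorem sep_mirror {lo hi : Fin k → ℝ} (hord : ∀ i j, i < j → hi i < lo j) (d : ℝ) :
    ∀ i j, i ≠ j → d - lo i < d - hi j ∨ d - lo j < d - hi i := fun i j hij => by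
  rcases lt_or_gt_of_ne hij with h | h
  · exact Or.inr (by linarith [hord i j h])
  · exact Or.inl (by linarith [hord j i h])

variable {n : ℕ}

/-- **Slabs of the joint family `mirror_d g ++ g`** (mirror copies in `[d − hi, d − lo]`, originals in `[lo, hi]`):
pairwise separated once `d ≥ 2s` with `s` above all slabs. -/
theorem joint_slabs (g : Fin n → 𝓢(E4, ℝ)) {lo hi : Fin n → ℝ} (hord : ∀ i j, i < j → hi i < lo j)
    (hsupp : ∀ i, tsupport (g i : E4 → ℝ) ⊆ {x | lo i ≤ x 0 ∧ x 0 ≤ hi i}) {s : ℝ} (hs : ∀ i, hi i < s)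
    {d : ℝ} (hd : 2 * s ≤ d) :
    ∃ LO HI : Fin (n + n) → ℝ,
      (∀ p, tsupport ((Fin.append (mirrorFamily 0 d g) g p : 𝓢(E4, ℝ)) : E4 → ℝ) ⊆
          {x | LO p ≤ x 0 ∧ x 0 ≤ HI p}) ∧
        ∀ p q, p ≠ q → HI p < LO q ∨ HI q < LO p := by
  refine ⟨Fin.append (fun i => d - hi i) lo, Fin.append (fun i => d - lo i) hi, fun p => ?_, fun p q hpq => ?_⟩
  · induction p using Fin.addCases with
    | left i => simpa only [Fin.append_left] using tsupport_mirrorFamily_subset 0 d g hsupp i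
    | right i => simpa only [Fin.append_right] using hsupp i
  · induction p using Fin.addCases with
    | left i =>
      induction q using Fin.addCases with
      | left j =>
        have hij : i ≠ j := fun h => hpq (by rw [h])
        simpa only [Fin.append_left] using sep_mirror hord d i j hij
      | right j =>
        simp only [Fin.append_left, Fin.append_right]
        exact Or.inr (by linarith [hs i, hs j])
    | right i =>
      induction q using Fin.addCases with
      | left j =>
        simp only [Fin.append_left, Fin.append_right]
        exact Or.inl (by linarith [hs i, hs j])
      | right j =>
        have hij : i ≠ j := fun h => hpq (by rw [h])
        simpa only [Fin.append_right] using sep_of_ordered hord i j hij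

end Sep

/-! ## §3 Mirror clustering along `e₀` for slab-ordered real families (E4/`HasMassGap` + E3 + translations) -/

section AxisZero

variable {n : ℕ} (S₁ : SchwingerFamily E4)

/-- E3 for one field: `S₁(F^π) = S₁(F)` on `⁰𝒮`. -/
theorem symm_apply (hE3 : S₁.toLabelled.IsSymmetric) {k : ℕ} (π : Equiv.Perm (Fin k))
    (X : 𝓢((Fin k → E4), ℂ)) (hX : IsOffDiagonal X) : S₁ k (permTest π X) = S₁ k X := by
  simpa using hE3 k (fun _ => ()) π X hX

/-- **Mirror clustering along `e₀`, orderable case.**  For a real family supported in pairwise ordered closed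
time slabs, `mirrorCov S₁ g 0 d → 0`: after a translation by `−s e₀` and a permutation of the `2n` arguments the
joint tensor `mirror_d g ⊗ g` is `Θ F* ⊗ T_{d−2s} F` for the FIXED time-ordered tensor `F = ⊗_j (mirror_s g)_{n−1−j}`
(`s` above all slabs), and likewise `S₁(mirror_d g) = S₁(F)`, `S₁(g) = S₁(Θ F*)`; then `HasMassGap Δ` bounds the
covariance by `C e^{−Δ(d−2s)}`. -/
theorem tendsto_mirrorCov_axisZero
    (htr : ∀ (k : ℕ) (a : E4) (F : 𝓢((Fin k → E4), ℂ)), IsOffDiagonal F →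
      S₁ k (translateMulti a F) = S₁ k F)
    (hE3 : S₁.toLabelled.IsSymmetric) {Δ : ℝ} (hΔ : 0 < Δ) (hgap : S₁.toLabelled.HasMassGap Δ)
    (g : Fin n → 𝓢(E4, ℝ)) (lo hi : Fin n → ℝ) (hord : ∀ i j, i < j → hi i < lo j)
    (hsupp : ∀ i, tsupport (g i : E4 → ℝ) ⊆ {x | lo i ≤ x 0 ∧ x 0 ≤ hi i}) :
    Tendsto (fun d : ℝ => mirrorCov S₁ g 0 d) atTop (𝓝 0) := by
  -- a strict upper bound `s` of all slabs
  obtain ⟨M, hM⟩ := (Set.finite_range hi).bddAbove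
  obtain ⟨s, hs⟩ : ∃ s : ℝ, ∀ i, hi i < s := ⟨M + 1, fun i => by linarith [hM ⟨i, rfl⟩]⟩
  -- the fixed time-ordered tensor `F = ⊗_j (mirror_s g)_{rev j}`
  set φ : Fin n → 𝓢(E4, ℝ) := fun j => mirrorFamily 0 s g (Fin.rev j) with hφ_def
  set F : 𝓢((Fin n → E4), ℂ) := SchwartzMap.tensorFin n fun j => ofRealTest (φ j) with hF_def
  have hTF : IsTensorOf F fun j => ofRealTest (φ j) := isTensorOf_tensorFin _
  have hφsupp : ∀ j, tsupport (φ j : E4 → ℝ) ⊆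
      {x | s - hi (Fin.rev j) ≤ x 0 ∧ x 0 ≤ s - lo (Fin.rev j)} :=
    fun j => tsupport_mirrorFamily_subset 0 s g hsupp (Fin.rev j)
  have hFord : IsTimeOrdered F := by
    intro x hx
    have hmem : ∀ j, x j ∈ tsupport (ofRealTest (φ j) : E4 → ℂ) := hTF.tsupport_subset hx
    have hj : ∀ j, s - hi (Fin.rev j) ≤ x j 0 ∧ x j 0 ≤ s - lo (Fin.rev j) := fun j =>
      hφsupp j (RpClosure.tsupport_ofRealTest_subset _ (hmem j))
    refine ⟨fun j => ?_, fun j j' hjj' => ?_⟩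
    · linarith [(hj j).1, hs (Fin.rev j)]
    · show x j 0 < x j' 0
      linarith [(hj j).2, (hj j').1, hord (Fin.rev j') (Fin.rev j) (Fin.rev_lt_rev.2 hjj')]
  obtain ⟨C, hC⟩ := hgap n n (fun _ => ()) (fun _ => ()) F F hFord hFord
  -- the plain tensor `⊗ g` is `Θ F*` translated by `s e₀`
  set P : 𝓢((Fin n → E4), ℂ) := SchwartzMap.tensorFin n fun i => ofRealTest (g i) with hP_def
  have hTP : IsTensorOf P fun i => ofRealTest (g i) := isTensorOf_tensorFin _
  have hPoff : IsOffDiagonal P := isOffDiagonal_of_sep hTP hsupp (sep_of_ordered hord)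
  have hOs : osAdjoint F = translateMulti ((-s) • ee 0) P := by
    have h := hTF.osAdjoint
    have hfam : (fun i => ofRealTest (thetaTest 4 (φ (Fin.rev i)))) =
        fun i => ofRealTest (translateTest ((-s) • ee 0) (g i)) := by
      funext i
      rw [hφ_def]
      dsimp only
      rw [Fin.rev_rev, thetaTest_mirrorFamily]
    rw [hfam] at h
    exact h.unique (hTP.translateMulti _)
  have h3 : S₁ n P = S₁ n (osAdjoint F) := by rw [hOs, htr _ _ _ hPoff]
  -- the mirror tensor at displacement `s` is `F` up to the order of factors
  set Ms : 𝓢((Fin n → E4), ℂ) := SchwartzMap.tensorFin n fun i => ofRealTest (mirrorFamily 0 s g i)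
    with hMs_def
  have hTMs : IsTensorOf Ms fun i => ofRealTest (mirrorFamily 0 s g i) := isTensorOf_tensorFin _
  have hMsoff : IsOffDiagonal Ms :=
    isOffDiagonal_of_sep hTMs (fun i => tsupport_mirrorFamily_subset 0 s g hsupp i) (sep_mirror hord s)
  have hFMs : F = permTest Fin.revPerm Ms := by
    refine hTF.unique ?_
    have h := hTMs.permTest Fin.revPerm
    have hfam : ((fun i => ofRealTest (mirrorFamily 0 s g i)) ∘ Fin.revPerm.symm) =
        fun j => ofRealTest (φ j) := by
      funext j
      rw [hφ_def]
      simp only [Function.comp_apply, Fin.revPerm_symm, Fin.revPerm_apply]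
    rw [hfam] at h
    exact h
  -- the key estimate for `d ≥ 2s`
  have key : ∀ d : ℝ, 2 * s ≤ d → ‖mirrorCov S₁ g 0 d‖ ≤ C * Real.exp (-Δ * (d - 2 * s)) := by
    intro d hd
    have ht : 0 ≤ d - 2 * s := by linarith
    -- the witness `H = Θ F* ⊗ T_{d − 2s} F`
    set H : 𝓢((Fin (n + n) → E4), ℂ) :=
      (osAdjoint F).appendTensor (translateMulti (EuclideanSpace.single 0 (d - 2 * s)) F) with hH_def
    have hH : IsAppendTensorOf H (osAdjoint F) (translateMulti (EuclideanSpace.single 0 (d - 2 * s)) F) :=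
      isAppendTensorOf_appendTensor _ _
    have hest := hC (d - 2 * s) ht H hH
    simp only [SchwingerFamily.toLabelled_apply] at hest
    -- (2) the mirror tensor: `S₁(⊗ mirror_d g) = S₁(F)`
    set Md : 𝓢((Fin n → E4), ℂ) := SchwartzMap.tensorFin n fun i => ofRealTest (mirrorFamily 0 d g i)
      with hMd_def
    have hTMd : IsTensorOf Md fun i => ofRealTest (mirrorFamily 0 d g i) := isTensorOf_tensorFin _
    have hMdoff : IsOffDiagonal Md :=
      isOffDiagonal_of_sep hTMd (fun i => tsupport_mirrorFamily_subset 0 d g hsupp i) (sep_mirror hord d)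
    have hMds : translateMulti ((s - d) • ee 0) Md = Ms := by
      have h := hTMd.translateMulti ((s - d) • ee 0)
      have hfam : (fun i => ofRealTest (translateTest ((s - d) • ee 0) (mirrorFamily 0 d g i))) =
          fun i => ofRealTest (mirrorFamily 0 s g i) := by
        funext i
        rw [translateTest_mirrorFamily, add_sub_cancel]
      rw [hfam] at h
      exact h.unique hTMs
    have h2 : S₁ n Md = S₁ n F := by
      rw [hFMs, symm_apply S₁ hE3 _ _ hMsoff, ← hMds, htr _ _ _ hMdoff]
    -- (1) the joint tensor: `S₁(⊗ (mirror_d g ++ g)) = S₁(H)`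
    set J : 𝓢((Fin (n + n) → E4), ℂ) :=
      SchwartzMap.tensorFin (n + n) fun p => ofRealTest (Fin.append (mirrorFamily 0 d g) g p) with hJ_def
    have hTJ : IsTensorOf J fun p => ofRealTest (Fin.append (mirrorFamily 0 d g) g p) := isTensorOf_tensorFin _
    obtain ⟨LO, HI, hsuppJ, hsepJ⟩ := joint_slabs g hord hsupp hs hd
    have hJoff : IsOffDiagonal J := isOffDiagonal_of_sep hTJ hsuppJ hsepJ
    have hTJs := hTJ.translateMulti ((-s) • ee 0)
    have hJsoff : IsOffDiagonal (translateMulti ((-s) • ee 0) J) :=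
      isOffDiagonal_translate_of_sep (-s) hTJs hsuppJ hsepJ
    -- the block swap (with the mirror block reversed)
    let ρ : Equiv.Perm (Fin (n + n)) := finSumFinEquiv.symm.trans
      (((Equiv.sumComm (Fin n) (Fin n)).trans (Equiv.sumCongr (Equiv.refl (Fin n)) Fin.revPerm)).trans
        finSumFinEquiv)
    have hρl : ∀ i, ρ (Fin.castAdd n i) = Fin.natAdd n (Fin.rev i) := fun i => by
      show finSumFinEquiv (Sum.map _ _ (Sum.swap (finSumFinEquiv.symm (Fin.castAdd n i)))) = _
      rw [finSumFinEquiv_symm_apply_castAdd]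
      simp
    have hρr : ∀ i, ρ (Fin.natAdd n i) = Fin.castAdd n i := fun i => by
      show finSumFinEquiv (Sum.map _ _ (Sum.swap (finSumFinEquiv.symm (Fin.natAdd n i)))) = _
      rw [finSumFinEquiv_symm_apply_natAdd]
      simp
    set B : Fin (n + n) → 𝓢(E4, ℝ) := Fin.append (fun i => thetaTest 4 (φ (Fin.rev i)))
      (fun j => translateTest (EuclideanSpace.single 0 (d - 2 * s)) (φ j)) with hB_def
    have hAB : ∀ p, translateTest ((-s) • ee 0) (Fin.append (mirrorFamily 0 d g) g p) = B (ρ p) := by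
      intro p
      induction p using Fin.addCases with
      | left i =>
        rw [hρl, hB_def, Fin.append_left, Fin.append_right, hφ_def]
        dsimp only
        rw [Fin.rev_rev, translateTest_mirrorFamily, single_eq_smul_ee, translateTest_mirrorFamily]
        congr 1
        ring
      | right i =>
        rw [hρr, hB_def, Fin.append_right, Fin.append_left, hφ_def]
        dsimp only
        rw [Fin.rev_rev, thetaTest_mirrorFamily]
    have hTH : IsTensorOf H fun q => ofRealTest (B q) :=
      RpClosure.isTensorOf_osAdjoint_appendTensor hTF (hTF.translateMulti (EuclideanSpace.single 0 (d - 2 * s)))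
    have hTH' : IsTensorOf (permTest ρ (translateMulti ((-s) • ee 0) J)) fun q => ofRealTest (B q) := by
      have h := hTJs.permTest ρ
      have hfam :
          ((fun p => ofRealTest (translateTest ((-s) • ee 0) (Fin.append (mirrorFamily 0 d g) g p))) ∘ ρ.symm) =
            fun q => ofRealTest (B q) := by
        funext q
        simp only [Function.comp_apply]
        rw [hAB, Equiv.apply_symm_apply]
      rw [hfam] at h
      exact h
    have hHJ : H = permTest ρ (translateMulti ((-s) • ee 0) J) := hTH.unique hTH'
    have h1 : S₁ (n + n) J = S₁ (n + n) H := by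
      rw [hHJ, symm_apply S₁ hE3 ρ _ hJsoff, htr _ _ _ hJoff]
    -- assembling
    have hcov : mirrorCov S₁ g 0 d = S₁ (n + n) H - S₁ n (osAdjoint F) * S₁ n F := by
      show S₁ (n + n) J - S₁ n Md * S₁ n P = _
      rw [h1, h2, h3, mul_comm]
    rw [hcov]
    exact hest
  -- squeeze
  have hexp : Tendsto (fun d : ℝ => C * Real.exp (-Δ * (d - 2 * s))) atTop (𝓝 0) := by
    have h1 : Tendsto (fun d : ℝ => Δ * (d + -(2 * s))) atTop atTop :=
      Tendsto.const_mul_atTop hΔ (tendsto_atTop_add_const_right _ _ tendsto_id)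
    have h2 := (Real.tendsto_exp_neg_atTop_nhds_zero.comp h1).const_mul C
    rw [mul_zero] at h2
    refine h2.congr fun d => ?_
    simp only [Function.comp_apply]
    congr 2
    ring
  rw [tendsto_zero_iff_norm_tendsto_zero]
  refine squeeze_zero' (Eventually.of_forall fun d => norm_nonneg _) ?_ hexp
  filter_upwards [eventually_ge_atTop (2 * s)] with d hd
  exact key d hd

end AxisZero

end MirrorOrderable

open MirrorOrderable in
/-- **Registered sub-goal `stub_mirrorClustering_axisZero`** (the `e₀`-half of `stub_mirrorClustering_orderable`,
over the three clauses of `W₁` it uses: translation invariance on `⁰𝒮`, E3, `HasMassGap Δ` with `Δ > 0`).  For a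
real family supported in pairwise ordered closed time slabs the `e₀`-mirror covariance tends to `0`. -/
theorem stub_mirrorClustering_axisZero :
    ∀ (S₁ : SchwingerFamily E4), (∀ (k : ℕ) (a : E4) (F : 𝓢((Fin k → E4), ℂ)), IsOffDiagonal F →
      S₁ k (translateMulti a F) = S₁ k F) → S₁.toLabelled.IsSymmetric → ∀ (Δ : ℝ), 0 < Δ →
        S₁.toLabelled.HasMassGap Δ → ∀ (n : ℕ) (g : Fin n → 𝓢(E4, ℝ)) (lo hi : Fin n → ℝ),
          (∀ i j, i < j → hi i < lo j) → (∀ i, tsupport (g i : E4 → ℝ) ⊆ {x | lo i ≤ x 0 ∧ x 0 ≤ hi i}) →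
            Tendsto (fun d : ℝ => mirrorCov S₁ g 0 d) atTop (𝓝 0) :=
  fun S₁ htr hE3 _ hΔ hgap _ g lo hi hord hsupp => tendsto_mirrorCov_axisZero S₁ htr hE3 hΔ hgap g lo hi hord hsupp

end Summit.QuantumFields.YangMills.Cruxes.DiagonalMirrorRPR.KmsVarianceLukewarmDescent

end
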